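import Literature.IUT.HodgeTheaters.StableCurveTemperedDataOfSpecialFibreSec2A3Trichotomy
import Literature.IUT.HodgeTheaters.StableCurveTemperedDataOfSpecialFibreSec2OneCallNVLiteral
import HarnessLib

/-!
# NON-VACUITY of the print-faithful trichotomy binders of the §2 one-call ([IUTchI] Prop. 2.4 (ii), Cor. 2.5):
# `hVc_j`, the endpoint data of `Dd j` and the law `hA3tri_j` are JOINTLY INHABITED at an explicit datum

S. Mochizuki, *Inter-universal Teichmüller theory I*, kurims manuscript (May 2020), §2, Prop. 2.4 (ii) pp. 50–51 and
Cor. 2.5 p. 51 [cite: Mochizuki2012, Prop 2.4(ii) pp.50-51] [cite: Mochizuki2012, Cor 2.5 p.51] (D-0012 claim key, status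
disputed; nothing of the series is asserted here); [NodNon] Prop 3.9 (i) p. 322 [cite: HoshiMochizukiNodNon2011, Prop 3.9 (i) p.322];
[SemiAnbd] Rmk 5.3.1 p. 65 [cite: MochizukiSemiAnbd2006, Rmk 5.3.1, p. 65].

PROOF-ONLY companion (abc-iut cell, seat abc-iut-L5-t11 gen 15, row «SEC2-A3-TRICHOTOMY-TRANSFER» part 2) of
`StableCurveTemperedDataOfSpecialFibreSec2A3Trichotomy.lean` (p506978); no definition, no instance, no notation, no new
`Prop` fact.  p506978 re-keys the last law of the §2 one-call to the PRINT-FAITHFUL binder set {`hVc_j` ([SemiAnbd]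
Rmk 5.3.1: compact level-`j` verticial decomposition groups), arithmetic ENDPOINT DATA of `Dd j` with their side
conditions (two distinct branches of one edge, abutments, reference pro-edge, no loop, coverage), `hA3tri_j` (the
[AbsTopII] Prop 1.3 (iv) / [NodNon] Prop 3.9 (i) trichotomy in coset coordinates, stabilisers = CLOSURES)}.  abc-iut-L5-lead's
TOKEN STANDARD (b) asks that a displayed binder set be JOINTLY INHABITED at ONE explicit datum.  This file:

* § A (any genuine 𝔛-datum with COMPACT `Π^temp_{X_K}`): `isCompact_vertGp_of_vertGp_eq_top` — `hVc_j` holds for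
  decomposition data all of whose verticial groups are `⊤` (`Π^tp_j = Π^temp_{X_K} ⧸ admKer_j` is compact);
  `trichotomy_of_subsingleton_of_vertGp_eq_top` — `hA3tri_j` holds, by its FIRST disjunct, for decomposition data with at
  most one vertex per level and verticial groups `⊤` (then `closure ι_j(⊤) = ⊤` since `ι_j` is onto, p479269's
  `qTower_map_top_eq_top`) — for EVERY endpoint datum.
* § B headline `sec2_oneCall_trichotomy_nonvacuous`: for every prime `p` there is an EXPLICIT genuine 𝔛-datum
  (abc-iut-f-193 / abc-iut-L3's cusped free-profinite witness «[model: Π^temp = G_{ℚ_p} × F̂₂, one-vertex fibres]», through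
  p478892's exposed form) carrying `P : PiData`, a cusp, `hTF`, `hab`, `hadm`, at which — with `Dd j` the one-vertex
  branch-free decomposition data and the EMPTY endpoint datum — `hVc_j`, all seven endpoint side conditions, `hA3tri_j`
  AND the frame law `hI_j^frame` hold TOGETHER, and the conclusion Prop 2.4 (i)(ii)(iii) ∧ Cor 2.5 holds there (p493381's
  one-vertex call).  The (x)/(x′) origin binders of p506978's one-calls are inhabited at the same witness family by
  p497058 / p496462 § C (not re-derived here).

HONEST TAGS.  DEGENERATE / WEAK NV, LABELLED: one vertex, no edge — `hA3tri_j` holds for the one-vertex reason (first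
disjunct), the adjacency clauses are not exercised; a NON-degenerate witness needs a two-vertex tempered chart on the nose
(abc-iut-L3-t11 g12 sizing: L).  Inhabited ≠ discharged: nothing here says the trichotomy holds at a genuine stable curve
(FACT-class).  NV = consistency evidence for OUR binders only; typed ≠ inhabited ≠ discharged; nothing here asserts that
abc is proved or refuted, and nothing here bears on [IUTchIII] Cor. 3.12.
-/

noncomputable section

namespace Literature.IUT.HodgeTheaters

open _root_.Topology
open scoped Pointwise
open Literature.AnabelianGeometry.SemiGraphs Literature.AnabelianGeometry.SemiGraphs.ProfiniteSemiGraph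

universe uE

namespace StableCurveTemperedData

namespace OfSpecialFibre

variable {p : ℕ} [Fact p.Prime] (X : TemperedCurve p)

section PerDatum

variable (d : X.GroupLevelData) (T : SpecialFibreTower X.DeltaTemp)
  (Sigma SigmaHat : Set ℕ) (hsub : Sigma ⊆ SigmaHat) (hne : Set.Nonempty Sigma)
  (hprime : ∀ q ∈ SigmaHat, q.Prime)
  (S : SpecialFibreData (X.toTemperedArithmeticGroup d)) (h36 : S.Gc.Prop36Hypotheses)
  (hp : p ∉ Sigma) (TpH : Subgroup S.chart.G)
  (HatH : Subgroup (TemperedGraphGroupData.exists_completion_of_prop36 S.Gc h36 S.chart).choose)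
  (hle : TpH.map (TemperedGraphGroupData.exists_completion_of_prop36 S.Gc h36
    S.chart).choose_spec.choose.toMonoidHom ≤ HatH)
  (cuspMeetsH : {x : X.Pt // X.IsCusp x} → Prop)
  (P : SpecialFibreTower.PiData X d S T) {V B : ℕ → Type*}

/-! ### A. At a datum with compact `Π^temp_{X_K}`: `hVc_j` and `hA3tri_j` for one-vertex, `⊤`-verticial data -/

/-- **`hVc_j` at `⊤`-verticial decomposition data**: if `Π^temp_{X_K}` is compact then so is every level quotient
`Π^tp_j = Π^temp_{X_K} ⧸ admKer_j`, hence every verticial decomposition group equal to `⊤` is compact ([SemiAnbd]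
Rmk 5.3.1's compactness, met at the degenerate data).  WEAK-NV ingredient, labelled.
[cite: MochizukiSemiAnbd2006, Rmk 5.3.1, p. 65] [claim: Mochizuki2012, status: disputed] -/
theorem isCompact_vertGp_of_vertGp_eq_top [CompactSpace X.PiTemp]
    (Dd : ∀ j, DecompositionData ((qTowerOfSpecialFibreTower X T d S h36 Sigma SigmaHat hsub hne hprime hp TpH HatH hle cuspMeetsH P.admKer_normal_pi).Q j).Tp (V j) (B j))
    (htop : ∀ j v, (Dd j).vertGp v = ⊤) :
    ∀ (j : ℕ) (v : V j), IsCompact (((Dd j).vertGp v : Subgroup ((qTowerOfSpecialFibreTower X T d S h36 Sigma SigmaHat hsub hne hprime hp TpH HatH hle cuspMeetsH P.admKer_normal_pi).Q j).Tp) : Set ((qTowerOfSpecialFibreTower X T d S h36 Sigma SigmaHat hsub hne hprime hp TpH HatH hle cuspMeetsH P.admKer_normal_pi).Q j).Tp) := by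
  intro j v
  haveI : (admKerPi X T j).Normal := P.admKer_normal_pi j
  haveI : CompactSpace ((qTowerOfSpecialFibreTower X T d S h36 Sigma SigmaHat hsub hne hprime hp TpH HatH hle cuspMeetsH P.admKer_normal_pi).Q j).Tp := by
    change CompactSpace (X.PiTemp ⧸ admKerPi X T j)
    infer_instance
  rw [htop j v, Subgroup.coe_top]
  exact isCompact_univ

/-- **`hA3tri_j` at one-vertex, `⊤`-verticial decomposition data** (for EVERY endpoint datum): with at most one vertex
per level and `Π^temp_{𝔊,v} = ⊤`, compactness of `Π^temp_{X_K}` makes `ι_j` onto (p479269's `qTower_map_top_eq_top`), so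
the pro-vertex stabiliser `closure ι_j(⊤)` is all of `Π̂_j` and the trichotomy holds by its FIRST disjunct («the two
pro-vertices coincide»).  DEGENERATE: the adjacency clauses are not exercised.  WEAK-NV ingredient, labelled.
[cite: Mochizuki2012, Prop 2.4(ii) p.51] [cite: HoshiMochizukiNodNon2011, Prop 3.9 (i) p.322] [claim: Mochizuki2012, status: disputed] -/
theorem trichotomy_of_subsingleton_of_vertGp_eq_top [CompactSpace X.PiTemp]
    (Dd : ∀ j, DecompositionData ((qTowerOfSpecialFibreTower X T d S h36 Sigma SigmaHat hsub hne hprime hp TpH HatH hle cuspMeetsH P.admKer_normal_pi).Q j).Tp (V j) (B j))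
    (hV : ∀ j, Subsingleton (V j)) (htop : ∀ j v, (Dd j).vertGp v = ⊤) :
    ∀ (j : ℕ) (E : Type uE) (β₁ β₂ : E → B j) (src tgt : E → V j) (c₁ c₂ : E → ((qTowerOfSpecialFibreTower X T d S h36 Sigma SigmaHat hsub hne hprime hp TpH HatH hle cuspMeetsH P.admKer_normal_pi).Q j).Tp),
    (∀ e, (Dd j).edgeOf (β₁ e) = (Dd j).edgeOf (β₂ e)) → (∀ e, β₁ e ≠ β₂ e) →
    (∀ e, (Dd j).abut (β₁ e) = some (src e)) → (∀ e, (Dd j).abut (β₂ e) = some (tgt e)) →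
    (∀ e, MulAut.conj (c₁ e) • (Dd j).brGp (β₁ e) = MulAut.conj (c₂ e) • (Dd j).brGp (β₂ e)) →
    (∀ e, src e = tgt e → (c₁ e)⁻¹ * c₂ e ∉ (Dd j).vertGp (src e)) →
    (∀ (b b' : B j) (v w : V j), (Dd j).edgeOf b = (Dd j).edgeOf b' → b ≠ b' →
      (Dd j).abut b = some v → (Dd j).abut b' = some w → ∃ e, (β₁ e = b ∧ β₂ e = b') ∨ (β₁ e = b' ∧ β₂ e = b)) →
    ∀ (Λ : Subgroup X.PiTemp), IsCompact (Λ : Set X.PiTemp) → Λ ≠ ⊥ →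
    IsOpen (Λ.map X.augGK.toMonoidHom : Set X.GK) →
    ∀ (v w : V j) (g h γ : ((qTowerOfSpecialFibreTower X T d S h36 Sigma SigmaHat hsub hne hprime hp TpH HatH hle cuspMeetsH P.admKer_normal_pi).Q j).Hat),
      MulAut.conj γ • Λ.map (((qTowerOfSpecialFibreTower X T d S h36 Sigma SigmaHat hsub hne hprime hp TpH HatH hle cuspMeetsH P.admKer_normal_pi).qhat j).comp X.toHat.toMonoidHom) ≤
          MulAut.conj g • (((Dd j).vertGp v).map ((qTowerOfSpecialFibreTower X T d S h36 Sigma SigmaHat hsub hne hprime hp TpH HatH hle cuspMeetsH P.admKer_normal_pi).Q j).ι).topologicalClosure →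
      MulAut.conj γ • Λ.map (((qTowerOfSpecialFibreTower X T d S h36 Sigma SigmaHat hsub hne hprime hp TpH HatH hle cuspMeetsH P.admKer_normal_pi).qhat j).comp X.toHat.toMonoidHom) ≤
          MulAut.conj h • (((Dd j).vertGp w).map ((qTowerOfSpecialFibreTower X T d S h36 Sigma SigmaHat hsub hne hprime hp TpH HatH hle cuspMeetsH P.admKer_normal_pi).Q j).ι).topologicalClosure →
        (v = w ∧ g⁻¹ * h ∈ (((Dd j).vertGp v).map ((qTowerOfSpecialFibreTower X T d S h36 Sigma SigmaHat hsub hne hprime hp TpH HatH hle cuspMeetsH P.admKer_normal_pi).Q j).ι).topologicalClosure) ∨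
        (∃ (e : E) (k : ((qTowerOfSpecialFibreTower X T d S h36 Sigma SigmaHat hsub hne hprime hp TpH HatH hle cuspMeetsH P.admKer_normal_pi).Q j).Hat), ∃ p ∈ (((Dd j).vertGp (src e)).map ((qTowerOfSpecialFibreTower X T d S h36 Sigma SigmaHat hsub hne hprime hp TpH HatH hle cuspMeetsH P.admKer_normal_pi).Q j).ι).topologicalClosure,
              ∃ q ∈ (((Dd j).vertGp (tgt e)).map ((qTowerOfSpecialFibreTower X T d S h36 Sigma SigmaHat hsub hne hprime hp TpH HatH hle cuspMeetsH P.admKer_normal_pi).Q j).ι).topologicalClosure,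
              (src e = v ∧ tgt e = w ∧ g = k * ((qTowerOfSpecialFibreTower X T d S h36 Sigma SigmaHat hsub hne hprime hp TpH HatH hle cuspMeetsH P.admKer_normal_pi).Q j).ι (c₁ e) * p ∧ h = k * ((qTowerOfSpecialFibreTower X T d S h36 Sigma SigmaHat hsub hne hprime hp TpH HatH hle cuspMeetsH P.admKer_normal_pi).Q j).ι (c₂ e) * q) ∨
              (src e = w ∧ tgt e = v ∧ h = k * ((qTowerOfSpecialFibreTower X T d S h36 Sigma SigmaHat hsub hne hprime hp TpH HatH hle cuspMeetsH P.admKer_normal_pi).Q j).ι (c₁ e) * p ∧ g = k * ((qTowerOfSpecialFibreTower X T d S h36 Sigma SigmaHat hsub hne hprime hp TpH HatH hle cuspMeetsH P.admKer_normal_pi).Q j).ι (c₂ e) * q)) ∨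
        (∃ (u : V j) (f : ((qTowerOfSpecialFibreTower X T d S h36 Sigma SigmaHat hsub hne hprime hp TpH HatH hle cuspMeetsH P.admKer_normal_pi).Q j).Hat),
          (∃ (e : E) (k : ((qTowerOfSpecialFibreTower X T d S h36 Sigma SigmaHat hsub hne hprime hp TpH HatH hle cuspMeetsH P.admKer_normal_pi).Q j).Hat), ∃ p ∈ (((Dd j).vertGp (src e)).map ((qTowerOfSpecialFibreTower X T d S h36 Sigma SigmaHat hsub hne hprime hp TpH HatH hle cuspMeetsH P.admKer_normal_pi).Q j).ι).topologicalClosure,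
              ∃ q ∈ (((Dd j).vertGp (tgt e)).map ((qTowerOfSpecialFibreTower X T d S h36 Sigma SigmaHat hsub hne hprime hp TpH HatH hle cuspMeetsH P.admKer_normal_pi).Q j).ι).topologicalClosure,
              (src e = v ∧ tgt e = u ∧ g = k * ((qTowerOfSpecialFibreTower X T d S h36 Sigma SigmaHat hsub hne hprime hp TpH HatH hle cuspMeetsH P.admKer_normal_pi).Q j).ι (c₁ e) * p ∧ f = k * ((qTowerOfSpecialFibreTower X T d S h36 Sigma SigmaHat hsub hne hprime hp TpH HatH hle cuspMeetsH P.admKer_normal_pi).Q j).ι (c₂ e) * q) ∨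
              (src e = u ∧ tgt e = v ∧ f = k * ((qTowerOfSpecialFibreTower X T d S h36 Sigma SigmaHat hsub hne hprime hp TpH HatH hle cuspMeetsH P.admKer_normal_pi).Q j).ι (c₁ e) * p ∧ g = k * ((qTowerOfSpecialFibreTower X T d S h36 Sigma SigmaHat hsub hne hprime hp TpH HatH hle cuspMeetsH P.admKer_normal_pi).Q j).ι (c₂ e) * q)) ∧
          (∃ (e : E) (k : ((qTowerOfSpecialFibreTower X T d S h36 Sigma SigmaHat hsub hne hprime hp TpH HatH hle cuspMeetsH P.admKer_normal_pi).Q j).Hat), ∃ p ∈ (((Dd j).vertGp (src e)).map ((qTowerOfSpecialFibreTower X T d S h36 Sigma SigmaHat hsub hne hprime hp TpH HatH hle cuspMeetsH P.admKer_normal_pi).Q j).ι).topologicalClosure,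
              ∃ q ∈ (((Dd j).vertGp (tgt e)).map ((qTowerOfSpecialFibreTower X T d S h36 Sigma SigmaHat hsub hne hprime hp TpH HatH hle cuspMeetsH P.admKer_normal_pi).Q j).ι).topologicalClosure,
              (src e = u ∧ tgt e = w ∧ f = k * ((qTowerOfSpecialFibreTower X T d S h36 Sigma SigmaHat hsub hne hprime hp TpH HatH hle cuspMeetsH P.admKer_normal_pi).Q j).ι (c₁ e) * p ∧ h = k * ((qTowerOfSpecialFibreTower X T d S h36 Sigma SigmaHat hsub hne hprime hp TpH HatH hle cuspMeetsH P.admKer_normal_pi).Q j).ι (c₂ e) * q) ∨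
              (src e = w ∧ tgt e = u ∧ h = k * ((qTowerOfSpecialFibreTower X T d S h36 Sigma SigmaHat hsub hne hprime hp TpH HatH hle cuspMeetsH P.admKer_normal_pi).Q j).ι (c₁ e) * p ∧ f = k * ((qTowerOfSpecialFibreTower X T d S h36 Sigma SigmaHat hsub hne hprime hp TpH HatH hle cuspMeetsH P.admKer_normal_pi).Q j).ι (c₂ e) * q))) := by
  intro j E β₁ β₂ src tgt c₁ c₂ _ _ _ _ _ _ _ Λ _ _ _ v w g h γ _ _
  haveI := hV j
  refine Or.inl ⟨Subsingleton.elim _ _, ?_⟩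
  have hcl : (((Dd j).vertGp v).map ((qTowerOfSpecialFibreTower X T d S h36 Sigma SigmaHat hsub hne hprime hp TpH HatH hle cuspMeetsH P.admKer_normal_pi).Q j).ι).topologicalClosure = ⊤ := by
    rw [htop j v, qTower_map_top_eq_top X T Sigma SigmaHat hsub hne hprime d S h36 hp TpH HatH hle cuspMeetsH P j]
    exact top_le_iff.mp (Subgroup.le_topologicalClosure _)
  rw [hcl]
  exact Subgroup.mem_top _

end PerDatum

/-! ### B. Headline: the new binder set inhabited at one explicit datum, and the conclusion there -/

/-- **NON-VACUITY of p506978's print-faithful binder set (abc-iut-L5-lead TOKEN STANDARD (b) for the trichotomy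
spelling of the last law of IUTchI:Cor2.5).**  For every prime `p` there are an EXPLICIT genuine 𝔛-datum (abc-iut-f-193 /
abc-iut-L3's cusped free-profinite model «[model: Π^temp = G_{ℚ_p} × F̂₂, one-vertex fibres]» through p478892) with
`P : PiData` and a cusp, the level-`j` decomposition data `Dd j` (one vertex, no branch, `Π^temp_{𝔊,v} := ⊤`) and the
EMPTY endpoint datum, such that ALL the new binders of `prop24_cor25_ofPiData_byName_noRF_frame_of_freePro_trichotomy`
hold TOGETHER — `hVc_j` (`isCompact_vertGp_of_vertGp_eq_top`), the seven endpoint side conditions (vacuous over `Empty`),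
`hA3tri_j` (`trichotomy_of_subsingleton_of_vertGp_eq_top`) — jointly with the frame law `hI_j^frame` (p493381's
`arithStatementI_oneVertexDecompositionData`), AND [IUTchI] Prop. 2.4 (i)(ii)(iii) ∧ Cor. 2.5 hold at that datum (p493381's
one-vertex literal call at the canonical frame).  The remaining displayed binders (`hTF`/`hab`/`hadm`, (x)/(x′), cusp) are
inhabited at the same witness family by p478892 / p497058 / p496462 § C.  DEGENERATE / WEAK NV, LABELLED (one vertex, no
edge); NV = consistency evidence for OUR binders only; inhabited ≠ discharged.
[cite: Mochizuki2012, Prop 2.4(ii) pp.50-51] [cite: Mochizuki2012, Cor 2.5 p.51] [claim: Mochizuki2012, status: disputed] -/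
theorem sec2_oneCall_trichotomy_nonvacuous (p : ℕ) [Fact p.Prime] :
    ∃ (X : TemperedCurve p) (d : X.GroupLevelData) (S : SpecialFibreData (X.toTemperedArithmeticGroup d))
      (T : SpecialFibreTower X.DeltaTemp) (P : SpecialFibreTower.PiData X d S T) (_ : {x : X.Pt // X.IsCusp x})
      (Sigma : Set ℕ) (hne : Sigma.Nonempty) (hprime : ∀ q ∈ Sigma, q.Prime) (hp : p ∉ Sigma),
      (∃ (Dd : ∀ j, DecompositionData ((qTowerOfSpecialFibreTower X T d S S.hyp.toProp36Hypotheses Sigma Sigma Set.Subset.rfl hne hprime hp ⊤ ⊤ le_top (fun _ => True) P.admKer_normal_pi).Q j).Tp Unit Empty)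
          (β₁A β₂A : ∀ j : ℕ, Empty → Empty) (srcA tgtA : ∀ j : ℕ, Empty → Unit) (c₁A c₂A : ∀ j, Empty → ((qTowerOfSpecialFibreTower X T d S S.hyp.toProp36Hypotheses Sigma Sigma Set.Subset.rfl hne hprime hp ⊤ ⊤ le_top (fun _ => True) P.admKer_normal_pi).Q j).Tp),
        (∀ (j : ℕ) (v : Unit), IsCompact (((Dd j).vertGp v : Subgroup ((qTowerOfSpecialFibreTower X T d S S.hyp.toProp36Hypotheses Sigma Sigma Set.Subset.rfl hne hprime hp ⊤ ⊤ le_top (fun _ => True) P.admKer_normal_pi).Q j).Tp) : Set ((qTowerOfSpecialFibreTower X T d S S.hyp.toProp36Hypotheses Sigma Sigma Set.Subset.rfl hne hprime hp ⊤ ⊤ le_top (fun _ => True) P.admKer_normal_pi).Q j).Tp)) ∧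
        (∀ j e, (Dd j).edgeOf (β₁A j e) = (Dd j).edgeOf (β₂A j e)) ∧ (∀ j e, β₁A j e ≠ β₂A j e) ∧
        (∀ j e, (Dd j).abut (β₁A j e) = some (srcA j e)) ∧ (∀ j e, (Dd j).abut (β₂A j e) = some (tgtA j e)) ∧
        (∀ j e, MulAut.conj (c₁A j e) • (Dd j).brGp (β₁A j e) = MulAut.conj (c₂A j e) • (Dd j).brGp (β₂A j e)) ∧
        (∀ j e, srcA j e = tgtA j e → (c₁A j e)⁻¹ * c₂A j e ∉ (Dd j).vertGp (srcA j e)) ∧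
        (∀ (j : ℕ) (b b' : Empty) (v w : Unit), (Dd j).edgeOf b = (Dd j).edgeOf b' → b ≠ b' →
          (Dd j).abut b = some v → (Dd j).abut b' = some w →
            ∃ e, (β₁A j e = b ∧ β₂A j e = b') ∨ (β₁A j e = b' ∧ β₂A j e = b)) ∧
        (∀ (j : ℕ) (E : Type) (β₁ β₂ : E → Empty) (src tgt : E → Unit) (c₁ c₂ : E → ((qTowerOfSpecialFibreTower X T d S S.hyp.toProp36Hypotheses Sigma Sigma Set.Subset.rfl hne hprime hp ⊤ ⊤ le_top (fun _ => True) P.admKer_normal_pi).Q j).Tp),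
    (∀ e, (Dd j).edgeOf (β₁ e) = (Dd j).edgeOf (β₂ e)) → (∀ e, β₁ e ≠ β₂ e) →
    (∀ e, (Dd j).abut (β₁ e) = some (src e)) → (∀ e, (Dd j).abut (β₂ e) = some (tgt e)) →
    (∀ e, MulAut.conj (c₁ e) • (Dd j).brGp (β₁ e) = MulAut.conj (c₂ e) • (Dd j).brGp (β₂ e)) →
    (∀ e, src e = tgt e → (c₁ e)⁻¹ * c₂ e ∉ (Dd j).vertGp (src e)) →
    (∀ (b b' : Empty) (v w : Unit), (Dd j).edgeOf b = (Dd j).edgeOf b' → b ≠ b' →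
      (Dd j).abut b = some v → (Dd j).abut b' = some w → ∃ e, (β₁ e = b ∧ β₂ e = b') ∨ (β₁ e = b' ∧ β₂ e = b)) →
    ∀ (Λ : Subgroup X.PiTemp), IsCompact (Λ : Set X.PiTemp) → Λ ≠ ⊥ →
    IsOpen (Λ.map X.augGK.toMonoidHom : Set X.GK) →
    ∀ (v w : Unit) (g h γ : ((qTowerOfSpecialFibreTower X T d S S.hyp.toProp36Hypotheses Sigma Sigma Set.Subset.rfl hne hprime hp ⊤ ⊤ le_top (fun _ => True) P.admKer_normal_pi).Q j).Hat),
      MulAut.conj γ • Λ.map (((qTowerOfSpecialFibreTower X T d S S.hyp.toProp36Hypotheses Sigma Sigma Set.Subset.rfl hne hprime hp ⊤ ⊤ le_top (fun _ => True) P.admKer_normal_pi).qhat j).comp X.toHat.toMonoidHom) ≤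
          MulAut.conj g • (((Dd j).vertGp v).map ((qTowerOfSpecialFibreTower X T d S S.hyp.toProp36Hypotheses Sigma Sigma Set.Subset.rfl hne hprime hp ⊤ ⊤ le_top (fun _ => True) P.admKer_normal_pi).Q j).ι).topologicalClosure →
      MulAut.conj γ • Λ.map (((qTowerOfSpecialFibreTower X T d S S.hyp.toProp36Hypotheses Sigma Sigma Set.Subset.rfl hne hprime hp ⊤ ⊤ le_top (fun _ => True) P.admKer_normal_pi).qhat j).comp X.toHat.toMonoidHom) ≤
          MulAut.conj h • (((Dd j).vertGp w).map ((qTowerOfSpecialFibreTower X T d S S.hyp.toProp36Hypotheses Sigma Sigma Set.Subset.rfl hne hprime hp ⊤ ⊤ le_top (fun _ => True) P.admKer_normal_pi).Q j).ι).topologicalClosure →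
        (v = w ∧ g⁻¹ * h ∈ (((Dd j).vertGp v).map ((qTowerOfSpecialFibreTower X T d S S.hyp.toProp36Hypotheses Sigma Sigma Set.Subset.rfl hne hprime hp ⊤ ⊤ le_top (fun _ => True) P.admKer_normal_pi).Q j).ι).topologicalClosure) ∨
        (∃ (e : E) (k : ((qTowerOfSpecialFibreTower X T d S S.hyp.toProp36Hypotheses Sigma Sigma Set.Subset.rfl hne hprime hp ⊤ ⊤ le_top (fun _ => True) P.admKer_normal_pi).Q j).Hat), ∃ p ∈ (((Dd j).vertGp (src e)).map ((qTowerOfSpecialFibreTower X T d S S.hyp.toProp36Hypotheses Sigma Sigma Set.Subset.rfl hne hprime hp ⊤ ⊤ le_top (fun _ => True) P.admKer_normal_pi).Q j).ι).topologicalClosure,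
              ∃ q ∈ (((Dd j).vertGp (tgt e)).map ((qTowerOfSpecialFibreTower X T d S S.hyp.toProp36Hypotheses Sigma Sigma Set.Subset.rfl hne hprime hp ⊤ ⊤ le_top (fun _ => True) P.admKer_normal_pi).Q j).ι).topologicalClosure,
              (src e = v ∧ tgt e = w ∧ g = k * ((qTowerOfSpecialFibreTower X T d S S.hyp.toProp36Hypotheses Sigma Sigma Set.Subset.rfl hne hprime hp ⊤ ⊤ le_top (fun _ => True) P.admKer_normal_pi).Q j).ι (c₁ e) * p ∧ h = k * ((qTowerOfSpecialFibreTower X T d S S.hyp.toProp36Hypotheses Sigma Sigma Set.Subset.rfl hne hprime hp ⊤ ⊤ le_top (fun _ => True) P.admKer_normal_pi).Q j).ι (c₂ e) * q) ∨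
              (src e = w ∧ tgt e = v ∧ h = k * ((qTowerOfSpecialFibreTower X T d S S.hyp.toProp36Hypotheses Sigma Sigma Set.Subset.rfl hne hprime hp ⊤ ⊤ le_top (fun _ => True) P.admKer_normal_pi).Q j).ι (c₁ e) * p ∧ g = k * ((qTowerOfSpecialFibreTower X T d S S.hyp.toProp36Hypotheses Sigma Sigma Set.Subset.rfl hne hprime hp ⊤ ⊤ le_top (fun _ => True) P.admKer_normal_pi).Q j).ι (c₂ e) * q)) ∨
        (∃ (u : Unit) (f : ((qTowerOfSpecialFibreTower X T d S S.hyp.toProp36Hypotheses Sigma Sigma Set.Subset.rfl hne hprime hp ⊤ ⊤ le_top (fun _ => True) P.admKer_normal_pi).Q j).Hat),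
          (∃ (e : E) (k : ((qTowerOfSpecialFibreTower X T d S S.hyp.toProp36Hypotheses Sigma Sigma Set.Subset.rfl hne hprime hp ⊤ ⊤ le_top (fun _ => True) P.admKer_normal_pi).Q j).Hat), ∃ p ∈ (((Dd j).vertGp (src e)).map ((qTowerOfSpecialFibreTower X T d S S.hyp.toProp36Hypotheses Sigma Sigma Set.Subset.rfl hne hprime hp ⊤ ⊤ le_top (fun _ => True) P.admKer_normal_pi).Q j).ι).topologicalClosure,
              ∃ q ∈ (((Dd j).vertGp (tgt e)).map ((qTowerOfSpecialFibreTower X T d S S.hyp.toProp36Hypotheses Sigma Sigma Set.Subset.rfl hne hprime hp ⊤ ⊤ le_top (fun _ => True) P.admKer_normal_pi).Q j).ι).topologicalClosure,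
              (src e = v ∧ tgt e = u ∧ g = k * ((qTowerOfSpecialFibreTower X T d S S.hyp.toProp36Hypotheses Sigma Sigma Set.Subset.rfl hne hprime hp ⊤ ⊤ le_top (fun _ => True) P.admKer_normal_pi).Q j).ι (c₁ e) * p ∧ f = k * ((qTowerOfSpecialFibreTower X T d S S.hyp.toProp36Hypotheses Sigma Sigma Set.Subset.rfl hne hprime hp ⊤ ⊤ le_top (fun _ => True) P.admKer_normal_pi).Q j).ι (c₂ e) * q) ∨
              (src e = u ∧ tgt e = v ∧ f = k * ((qTowerOfSpecialFibreTower X T d S S.hyp.toProp36Hypotheses Sigma Sigma Set.Subset.rfl hne hprime hp ⊤ ⊤ le_top (fun _ => True) P.admKer_normal_pi).Q j).ι (c₁ e) * p ∧ g = k * ((qTowerOfSpecialFibreTower X T d S S.hyp.toProp36Hypotheses Sigma Sigma Set.Subset.rfl hne hprime hp ⊤ ⊤ le_top (fun _ => True) P.admKer_normal_pi).Q j).ι (c₂ e) * q)) ∧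
          (∃ (e : E) (k : ((qTowerOfSpecialFibreTower X T d S S.hyp.toProp36Hypotheses Sigma Sigma Set.Subset.rfl hne hprime hp ⊤ ⊤ le_top (fun _ => True) P.admKer_normal_pi).Q j).Hat), ∃ p ∈ (((Dd j).vertGp (src e)).map ((qTowerOfSpecialFibreTower X T d S S.hyp.toProp36Hypotheses Sigma Sigma Set.Subset.rfl hne hprime hp ⊤ ⊤ le_top (fun _ => True) P.admKer_normal_pi).Q j).ι).topologicalClosure,
              ∃ q ∈ (((Dd j).vertGp (tgt e)).map ((qTowerOfSpecialFibreTower X T d S S.hyp.toProp36Hypotheses Sigma Sigma Set.Subset.rfl hne hprime hp ⊤ ⊤ le_top (fun _ => True) P.admKer_normal_pi).Q j).ι).topologicalClosure,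
              (src e = u ∧ tgt e = w ∧ f = k * ((qTowerOfSpecialFibreTower X T d S S.hyp.toProp36Hypotheses Sigma Sigma Set.Subset.rfl hne hprime hp ⊤ ⊤ le_top (fun _ => True) P.admKer_normal_pi).Q j).ι (c₁ e) * p ∧ h = k * ((qTowerOfSpecialFibreTower X T d S S.hyp.toProp36Hypotheses Sigma Sigma Set.Subset.rfl hne hprime hp ⊤ ⊤ le_top (fun _ => True) P.admKer_normal_pi).Q j).ι (c₂ e) * q) ∨
              (src e = w ∧ tgt e = u ∧ h = k * ((qTowerOfSpecialFibreTower X T d S S.hyp.toProp36Hypotheses Sigma Sigma Set.Subset.rfl hne hprime hp ⊤ ⊤ le_top (fun _ => True) P.admKer_normal_pi).Q j).ι (c₁ e) * p ∧ f = k * ((qTowerOfSpecialFibreTower X T d S S.hyp.toProp36Hypotheses Sigma Sigma Set.Subset.rfl hne hprime hp ⊤ ⊤ le_top (fun _ => True) P.admKer_normal_pi).Q j).ι (c₂ e) * q)))) ∧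
        (∀ j,
          haveI := qTower_map_N_normal X d T Sigma Sigma Set.Subset.rfl hne hprime S S.hyp.toProp36Hypotheses hp ⊤ ⊤
            le_top (fun _ => True) P j;
          ArithMaximalCompactStatementI (Dd j)
            (QuotientGroup.mk' (((T.N j).map X.DeltaTemp.subtype).map
              ((qTowerOfSpecialFibreTower X T d S S.hyp.toProp36Hypotheses Sigma Sigma Set.Subset.rfl hne hprime hp ⊤ ⊤ le_top (fun _ => True) P.admKer_normal_pi).qtp j))))) ∧
      (((ofSpecialFibre X d S S.hyp.toProp36Hypotheses Sigma Sigma Set.Subset.rfl hne hprime hp ⊤ ⊤ le_top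
            (fun _ => True)).Prop24i ∧
        (ofSpecialFibre X d S S.hyp.toProp36Hypotheses Sigma Sigma Set.Subset.rfl hne hprime hp ⊤ ⊤ le_top
            (fun _ => True)).Prop24ii ∧
        (ofSpecialFibre X d S S.hyp.toProp36Hypotheses Sigma Sigma Set.Subset.rfl hne hprime hp ⊤ ⊤ le_top
            (fun _ => True)).Prop24iii) ∧
      ((ofSpecialFibre X d S S.hyp.toProp36Hypotheses Sigma Sigma Set.Subset.rfl hne hprime hp ⊤ ⊤ le_top
            (fun _ => True)).Cor25Decomposition ∧
        (ofSpecialFibre X d S S.hyp.toProp36Hypotheses Sigma Sigma Set.Subset.rfl hne hprime hp ⊤ ⊤ le_top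
            (fun _ => True)).Cor25Inertia)) := by
  -- (`have` + `rcases`, not `obtain … := term`: generalising the term over this goal is expensive)
  have hw := exists_piData_cusp_torsionFreeAb_ab_adm_exposed p
  rcases hw with ⟨X, d, S, T, ⟨P⟩, -, -, ⟨x⟩, -, hTF, hab, hadm, hcpt, hUV, -, -, htop, -⟩
  haveI := hcpt
  -- a prime `q ≠ p`: `Σ := {q}`
  let q : ℕ := if p = 2 then 3 else 2
  have hq : q.Prime := by
    by_cases h : p = 2
    · simp only [q, h, if_true]; exact Nat.prime_three
    · simp only [q, h, if_false]; exact Nat.prime_two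
  have hpq : p ≠ q := by
    by_cases h : p = 2
    · simp only [q, h, if_true]; decide
    · simp only [q, h, if_false]; exact h
  have hprime : ∀ r ∈ ({q} : Set ℕ), r.Prime := fun r hr => by rw [Set.mem_singleton_iff.mp hr]; exact hq
  have hp : p ∉ ({q} : Set ℕ) := fun h => hpq (Set.mem_singleton_iff.mp h)
  haveI hN := fun j => qTower_map_N_normal X d T {q} {q} Set.Subset.rfl (Set.singleton_nonempty q) hprime S
    S.hyp.toProp36Hypotheses hp ⊤ ⊤ le_top (fun _ => True) P j
  refine ⟨X, d, S, T, P, x, {q}, Set.singleton_nonempty q, hprime, hp, ?_, ?_⟩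
  · -- (1) the new binder set at the one-vertex branch-free data with the EMPTY endpoint datum
    let Dd : ∀ j : ℕ, DecompositionData (((qTowerOfSpecialFibreTower X T d S S.hyp.toProp36Hypotheses {q} {q} Set.Subset.rfl (Set.singleton_nonempty q) hprime hp ⊤ ⊤ le_top (fun _ => True) P.admKer_normal_pi)).Q j).Tp Unit Empty :=
      fun _ =>
        { E := Empty
          edgeOf := fun b => b.elim
          abut := fun b => b.elim
          vertGp := fun _ => ⊤
          brGp := fun b => b.elim
          brGp_le_vertGp := fun b => b.elim }
    have htopD : ∀ j v, (Dd j).vertGp v = ⊤ := fun _ _ => rfl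
    refine ⟨Dd, fun _ e => e.elim, fun _ e => e.elim, fun _ e => e.elim, fun _ e => e.elim, fun _ e => e.elim,
      fun _ e => e.elim, ?_, fun _ e => e.elim, fun _ e => e.elim, fun _ e => e.elim, fun _ e => e.elim,
      fun _ e => e.elim, fun _ e => e.elim, fun _ b => b.elim, ?_, fun j => ?_⟩
    · exact isCompact_vertGp_of_vertGp_eq_top X d T {q} {q} Set.Subset.rfl (Set.singleton_nonempty q) hprime S
        S.hyp.toProp36Hypotheses hp ⊤ ⊤ le_top (fun _ => True) P Dd htopD
    · exact trichotomy_of_subsingleton_of_vertGp_eq_top X d T {q} {q} Set.Subset.rfl (Set.singleton_nonempty q)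
        hprime S S.hyp.toProp36Hypotheses hp ⊤ ⊤ le_top (fun _ => True) P Dd (fun _ => inferInstance) htopD
    · exact arithStatementI_oneVertexDecompositionData _
  · -- (2) the conclusion at the datum: p493381's one-vertex LITERAL call at the canonical frame
    exact prop24_cor25_ofPiData_byName_literal_of_oneVertexFibres X T {q} {q} Set.Subset.rfl
      (Set.singleton_nonempty q) hprime d S S.hyp.toProp36Hypotheses hp ⊤ ⊤ le_top (fun _ => True) P x hUV htop hTF
      (hab {q}) hadm
      (PA := fun j => (((qTowerOfSpecialFibreTower X T d S S.hyp.toProp36Hypotheses {q} {q} Set.Subset.rfl (Set.singleton_nonempty q) hprime hp ⊤ ⊤ le_top (fun _ => True) P.admKer_normal_pi)).Q j).Tp ⧸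
        ((T.N j).map X.DeltaTemp.subtype).map (((qTowerOfSpecialFibreTower X T d S S.hyp.toProp36Hypotheses {q} {q} Set.Subset.rfl (Set.singleton_nonempty q) hprime hp ⊤ ⊤ le_top (fun _ => True) P.admKer_normal_pi)).qtp j))
      (fun j => QuotientGroup.mk' _)
      (fun j => isOpenMap_frame X d T {q} {q} Set.Subset.rfl (Set.singleton_nonempty q) hprime S
        S.hyp.toProp36Hypotheses hp ⊤ ⊤ le_top (fun _ => True) P j)
      (fun j n hn => frame_apply_eq_one X d T {q} {q} Set.Subset.rfl (Set.singleton_nonempty q) hprime S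
        S.hyp.toProp36Hypotheses hp ⊤ ⊤ le_top (fun _ => True) P j n hn)

end OfSpecialFibre

end StableCurveTemperedData

end Literature.IUT.HodgeTheaters

end
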